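import Summits.ABC.IUTFork.Conditional.WRowUnconditionalPackages
import Literature.IUT.LogVolume.UnitLogValuationProfile
import HarnessLib

/-!
# R-W «OPEN-SINGLE-PRIMES» — the inner witness at the CEILING slot `ρin = ⌈e/(p−1)⌉`: in EVERY proper ultrametric `ℚ_p`-field (`p` odd)
# a non-member of `log_p(𝒪_K^×)` of norm `≤ p^{−(⌈e/(p−1)⌉−1)/e}`, hypothesis-free; under `(p − 1) ∤ e` this is the slot `⌊e/(p−1)⌋ + 1`

PROOF-ONLY file (D-0012; 0 definitions, 0 `Prop` facts) of the abc-iut cell — D-0079 RESCUE sub-cell R-W «WINDOW Θ-SIDE INEQUALITY», seat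
abc-iut-W-neg-1 (gen 5), row «OPEN-SINGLE-PRIMES» (abc-iut-plan C-R105 (a); KEY `wake/KEY-abc-iut-W-neg-1-OPENSINGLEPRIMES.md`). READING OF THE
TYPE (neutral): in abc-iut-W-row-1's licence socket `Cor312Prov.licence_settingPrVolSharp_pilotDataOfK_of_orders_rat` the inner radius
`ρin : Nat.Primes → ℤ` is a FREE binder carrying only the witness obligation `∃ z ∉ log_p(𝒪^×_{K_x}), ‖z‖ ≤ p^{−(ρin−1)/e}`; the «integer slot»
`⌊e/(p−1)⌋` is what abc-iut-c312-5's `WRow.inner_witness_slot` supplies for every `K`. abc-iut-W-num-5 (ENGINEC-CEIL-ONLY-LEVELS.tsv a14426db4c9d93ee)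
lists 22 axis levels (e.g. `l = 1,322,641` of the `67`-triple, `l = 4723` of HEX `k = 10`) where the exact hull cell fails at the top label under
`⌊e/(p−1)⌋` and holds under `⌊e/(p−1)⌋ + 1`, all at TAME poles with `(p − 1) ∤ e`. THIS FILE supplies that radius in kernel, from abc-iut-rp-d4's
valuation profile of `log_p(𝒪_K^×)` (`Literature.IUT.LogVolume.ValuationProfile.norm_ne_zpow_floor_of_mem_logUnits`, `UnitLogValuationProfile.lean` §4:
with `r₁·(p−1) < e < (r₁+1)·(p−1)` NO log-unit has norm `‖ϖ‖^{r₁}`), and packages it with c312-5's tie witness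
(`LogEnvelope.exists_not_mem_logUnits_norm_le_rpow_level_intSlot`, `e = A·(p−1)`) into ONE hypothesis-free witness at the CEILING `⌈e/(p−1)⌉`:

* `WRow.unif_pow_div_not_mem_logUnits` — `(p − 1) ∤ e ⇒ ϖ^{⌊e/(p−1)⌋} ∉ log_p(𝒪_K^×)` (any uniformizer `ϖ`);
* `WRow.inner_witness_slot_succ` — `(p − 1) ∤ e`, `ρin = ⌊e/(p−1)⌋ + 1`: `∃ z ∉ log_p(𝒪_K^×), ‖z‖ ≤ p^{−(ρin−1)/e}` (socket binder form);
* `WRow.ceilSlot_eq_of_not_dvd` / `WRow.ceilSlot_eq_of_dvd` — `⌈e/(p−1)⌉ = (e + (p−2))/(p−1)` equals `⌊e/(p−1)⌋ + 1`, resp. `e/(p−1)`;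
* `WRow.inner_witness_ceil` — `p` odd, ANY `K`, `ρin = ((e + (p − 2))/(p − 1) : ℕ)`: `∃ z ∉ log_p(𝒪_K^×), ‖z‖ ≤ p^{−(ρin−1)/e}`.

The ceiling is SHARP: `{‖z‖ ≤ ‖ϖ‖ʳ} ⊆ log_p(𝒪_K^×) ⟺ e < r·(p−1)` (abc-iut-rp-d4 `UnitLogValuationProfileShell`), so no larger `ρin` has a witness.
Consumers (record only): this seat's `InhUniformBandFrey31117999167337103924704Level1322641` and the HEX `k = 10` level `4723`. HONEST SCOPE: classical local
number theory (Neukirch II (5.5)–(5.7)); `logUnits` is the cell's typing of [IUTchIV] Prop. 1.2's `log_p(R^×)` ([claim: Mochizuki2012, status: disputed]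
for that locution only); nothing here bears on the printed inequality of [IUTchIII] Cor. 3.12; no side taken on any author; no abc claim.
[cite: NeukirchANT1999, Ch. II Prop. (5.5)–(5.7)] [cite: Mochizuki2012, IUTchIV Prop. 1.2 (i)(ii) p. 10] [claim: Mochizuki2012, status: disputed]
-/

noncomputable section

open Set Function Metric

namespace Summit.ABC.IUTFork.Conditional

open Literature.IUT.LogVolume Literature.NumberTheory.GaloisRepresentations.Ultrametric

section Local

variable (p : ℕ) [hp : Fact p.Prime] {K : Type} [NontriviallyNormedField K] [instK : NormedAlgebra ℚ_[p] K]
  [IsUltrametricDist K] [ProperSpace K]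

include instK in
/-- **`ϖ^{⌊e/(p−1)⌋}` is not a logarithm of a unit when `(p − 1) ∤ e`**: `⌊e/(p−1)⌋·(p−1) < e < (⌊e/(p−1)⌋+1)·(p−1)`, so by abc-iut-rp-d4's
`ValuationProfile.norm_ne_zpow_floor_of_mem_logUnits` no log-unit has norm `‖ϖ‖^{⌊e/(p−1)⌋}`. [cite: NeukirchANT1999, Ch. II Prop. (5.5)–(5.7)] -/
theorem WRow.unif_pow_div_not_mem_logUnits {ϖ : Kˣ} (hϖ : IsUniformizer ϖ) (hnd : ¬ (p - 1) ∣ absRamificationIdx p K) :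
    (ϖ : K) ^ (absRamificationIdx p K / (p - 1)) ∉ logUnits K := by
  intro hz
  have hp1 : 0 < p - 1 := by have := hp.out.two_le; omega
  have hcast : (((p - 1 : ℕ)) : ℤ) = (p : ℤ) - 1 := by have := hp.out.two_le; omega
  have h1 : absRamificationIdx p K / (p - 1) * (p - 1) < absRamificationIdx p K := by
    rcases (Nat.div_mul_le_self (absRamificationIdx p K) (p - 1)).lt_or_eq with h | h
    · exact h
    · exact absurd (Dvd.intro_left _ h) hnd
  have h2 : absRamificationIdx p K < (absRamificationIdx p K / (p - 1) + 1) * (p - 1) := by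
    rw [Nat.add_mul, one_mul]
    exact Nat.lt_div_mul_add hp1
  have h1z : (((absRamificationIdx p K / (p - 1) : ℕ)) : ℤ) * ((p : ℤ) - 1) < absRamificationIdx p K := by
    rw [← hcast]; exact_mod_cast h1
  have h2z : (absRamificationIdx p K : ℤ) < ((((absRamificationIdx p K / (p - 1) : ℕ)) : ℤ) + 1) * ((p : ℤ) - 1) := by
    rw [← hcast]; exact_mod_cast h2
  exact ValuationProfile.norm_ne_zpow_floor_of_mem_logUnits p hnd hϖ h1z h2z hz (by rw [zpow_natCast, norm_pow])

include instK in
/-- **Inner witness one above the integer slot** (`(p − 1) ∤ e`, ANY `K`): with `ρin = ⌊e/(p−1)⌋ + 1` some `z ∉ log_p(𝒪_K^×)` has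
`‖z‖ ≤ p^{−(ρin−1)/e}` — namely `z = ϖ^{⌊e/(p−1)⌋}`, of norm exactly `p^{−⌊e/(p−1)⌋/e}` — in the socket's binder form of
`WRow.inner_witness_slot`. [cite: NeukirchANT1999, Ch. II Prop. (5.5)–(5.7)] -/
theorem WRow.inner_witness_slot_succ {e : ℕ} (hE : absRamificationIdx p K = e) (hnd : ¬ (p - 1) ∣ e) {ρin : ℤ}
    (hρin : ρin = ((e / (p - 1) : ℕ) : ℤ) + 1) :
    ∃ z : K, z ∉ logUnits K ∧ ‖z‖ ≤ (p : ℝ) ^ (-(((ρin : ℝ) - 1) / (e : ℝ))) := by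
  obtain ⟨ϖ, hϖ⟩ := exists_isUniformizer (F := K)
  subst hE
  refine ⟨(ϖ : K) ^ (absRamificationIdx p K / (p - 1)), WRow.unif_pow_div_not_mem_logUnits p hϖ hnd, le_of_eq ?_⟩
  rw [norm_pow, LogEnvelope.norm_unif_pow_eq_rpow p hϖ, hρin]
  congr 1
  simp only [Int.cast_add, Int.cast_one, Int.cast_natCast]
  ring

/-- `⌈e/(p−1)⌉ = ⌊e/(p−1)⌋ + 1` off the ties: `(e + (p−2))/(p−1) = e/(p−1) + 1` when `(p − 1) ∤ e` (`p ≥ 2`). [folklore] -/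
theorem WRow.ceilSlot_eq_of_not_dvd {p e : ℕ} (hp2 : 2 ≤ p) (hnd : ¬ (p - 1) ∣ e) : (e + (p - 2)) / (p - 1) = e / (p - 1) + 1 := by
  have hp1 : 0 < p - 1 := by omega
  set r := e / (p - 1) with hr
  have h1 : r * (p - 1) < e := by
    rcases (Nat.div_mul_le_self e (p - 1)).lt_or_eq with h | h
    · exact h
    · exact absurd (Dvd.intro_left _ h) hnd
  have h2 : e < r * (p - 1) + (p - 1) := Nat.lt_div_mul_add hp1
  apply le_antisymm
  · have : (e + (p - 2)) / (p - 1) < r + 1 + 1 := by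
      rw [Nat.div_lt_iff_lt_mul hp1]
      have : (r + 1 + 1) * (p - 1) = r * (p - 1) + (p - 1) + (p - 1) := by ring
      omega
    omega
  · rw [Nat.le_div_iff_mul_le hp1]
    have : (r + 1) * (p - 1) = r * (p - 1) + (p - 1) := by ring
    omega

/-- `⌈e/(p−1)⌉ = e/(p−1)` at a tie: `(e + (p−2))/(p−1) = e/(p−1)` when `(p − 1) ∣ e` (`p ≥ 2`). [folklore] -/
theorem WRow.ceilSlot_eq_of_dvd {p e : ℕ} (hp2 : 2 ≤ p) (hd : (p - 1) ∣ e) : (e + (p - 2)) / (p - 1) = e / (p - 1) := by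
  have hp1 : 0 < p - 1 := by omega
  set r := e / (p - 1) with hr
  have h1 : r * (p - 1) = e := Nat.div_mul_cancel hd
  apply le_antisymm
  · have : (e + (p - 2)) / (p - 1) < r + 1 := by
      rw [Nat.div_lt_iff_lt_mul hp1]
      have : (r + 1) * (p - 1) = r * (p - 1) + (p - 1) := by ring
      omega
    omega
  · rw [Nat.le_div_iff_mul_le hp1]
    omega

include instK in
/-- **Inner witness at the CEILING slot, every odd `p`, every `K`, NO hypothesis**: with `ρin = ⌈e/(p−1)⌉ = (e + (p−2))/(p−1)` some
`z ∉ log_p(𝒪_K^×)` has `‖z‖ ≤ p^{−(ρin−1)/e}`. Off the ties (`(p − 1) ∤ e`) this is `WRow.inner_witness_slot_succ` (`ϖ^{⌊e/(p−1)⌋}`, abc-iut-rp-d4's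
profile gap); at a tie `e = A·(p−1)` it is abc-iut-c312-5's `LogEnvelope.exists_not_mem_logUnits_norm_le_rpow_level_intSlot` (`ρin = A`, the
deep-tie bracket, `ζ_p ∈ K` allowed). The inner-radius binder of the licence socket may therefore ALWAYS be fed the ceiling.
[cite: NeukirchANT1999, Ch. II Prop. (5.5)–(5.7)] -/
theorem WRow.inner_witness_ceil (hp2 : p ≠ 2) {e : ℕ} (hE : absRamificationIdx p K = e) {ρin : ℤ}
    (hρin : ρin = (((e + (p - 2)) / (p - 1) : ℕ) : ℤ)) :
    ∃ z : K, z ∉ logUnits K ∧ ‖z‖ ≤ (p : ℝ) ^ (-(((ρin : ℝ) - 1) / (e : ℝ))) := by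
  have hp2' : 2 ≤ p := hp.out.two_le
  by_cases hd : (p - 1) ∣ e
  · obtain ⟨ϖ, hϖ⟩ := exists_isUniformizer (F := K)
    have hA : absRamificationIdx p K = e / (p - 1) * (p - 1) := by rw [Nat.div_mul_cancel hd, hE]
    have h := LogEnvelope.exists_not_mem_logUnits_norm_le_rpow_level_intSlot p hϖ hA hp2
    rw [hE] at h
    rw [hρin, WRow.ceilSlot_eq_of_dvd hp2' hd]
    exact h
  · rw [WRow.ceilSlot_eq_of_not_dvd hp2' hd] at hρin
    push_cast at hρin
    exact WRow.inner_witness_slot_succ p hE hd hρin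

end Local

end Summit.ABC.IUTFork.Conditional

end
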